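import Literature.Barriers.RiemannHypothesis.EpsteinZetaCentralValue
import Literature.Analysis.SpecialFunctions.EulerMascheroniBounds
import Literature.NumberTheory.LFunctions.LevinsonMontgomery
import HarnessLib

/-!
# Bateman–Grosswald (10) proved: `ζ_Q(½) > 0` for `k ≥ 7.0556`, hence `BatemanGrosswald1964_realZero_holds`

Third proof file next to `Literature/Barriers/RiemannHypothesis/EpsteinZetaRealZeros.lean` (barrier
`EpsteinZetaRealZeros = BatemanGrosswald1964_realZero ∧ Stark1967_thm1`). It DISCHARGES the named
fact `BatemanGrosswald1964_realZero` ("`ζ(s, Q)` has a real zero between `½` and `1` if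
`k > 7.0556`", Bateman–Grosswald 1964 via Stark 1967 §1): `BatemanGrosswald1964_realZero_holds`.
No new definitions; everything here is proved. The barrier is thereby reduced to Stark's Theorem 1
(`EpsteinZetaRealZeros_of_stark`).

## The source and the proof given here

P. T. Bateman, E. Grosswald, *On Epstein's zeta function*, Acta Arith. 9 (1964) 365–373, Theorem 3:
"If `k ≥ √3/2`, then (9) `a^{½} Z(½) = γ + log k − log 4π + 2θk^{−½}e^{−2πk}`, where `γ` is Euler's
constant and `−1 < θ < 1`. Thus (10) `Z(½) > 0` if `k ≥ 7.0556` […]. Since `Z(s)` approaches `−∞`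
when `s` approaches `1` from below, it follows from Theorem 3 that `Z(s)` vanishes in `(½, 1)` if
`k ≥ 7.0556`." Their proof of (9) goes through the Chowla–Selberg formula (Theorem 1) and bounds
for `K`-Bessel functions (Theorem 2, Lemmas 1–3).

Here (10) is proved WITHOUT Bessel functions, by Riemann's method, for the Mellin transform
`Λ_z = Λ₀,z − 1/s − 1/(1 − s)` of the lattice theta series `Θ_z(t) = Σ_{(m,n)} e^{−πt|mz+n|²/y}`
(`Literature.NumberTheory.Automorphic.thetaFEPair`; `Λ_z(½) = 2√k · a^{½} Z(½)` for
`z = b/(2a) + ik`, and every continuation of `ζ_Q` is a positive multiple of `Λ_z` on `(0, 1)`,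
`continuation_ofReal_eq`):

1. `Θ_z(t) ≥ Σ_n e^{−πtn²/y} = ϑ(t/y)` (the terms `(0, n)`; `ϑ = HurwitzZeta.evenKernel 0` is the
   Jacobi theta function, `evenKernel_div_le_thetaQ`), and `Θ_z(t) = t⁻¹Θ_z(1/t)`; hence the Mellin
   integrand `f̃_z = 𝟙_{(1,∞)}(Θ_z − 1) + 𝟙_{(0,1)}(Θ_z − t⁻¹)` of `Λ₀,z` dominates
   `ℓ(t) = g(t/y) + t⁻¹g(1/(ty))`, `g = 𝟙_{(1/y,1)∪(1,∞)}(ϑ − 1)` (`minorant_le_re_f_modif`).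
2. `mellin ℓ (½) = 2 mellin (g(·/y)) (½) = 2√y · mellin g (½)` (`t ↦ 1/t` and `t ↦ t/y`,
   `mellin_inv_mul_comp_inv`, `mellin_comp_inv_mul`).
3. `g = f̃^H + d` with `f̃^H = 𝟙_{(1,∞)}(ϑ − 1) + 𝟙_{(0,1)}(ϑ − u^{−½})` the Mellin integrand of
   Mathlib's even Hurwitz pair at `a = 0`, whose transform at `½` is
   `Λ₀^H(½) = 2·completedRiemannZeta₀(1) = 2 + γ − log 4π` (**Mathlib's `completedRiemannZeta₀_one`**
   — this is where `γ − log 4π` enters), and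
   `mellin d (½) = ∫_{1/y}^1 (u⁻¹ − u^{−½}) du − T'(y) = log y − 2 + 2/√y − T'(y)` with the tail
   `T'(y) = ∫₀^{1/y} u^{−½}(ϑ(u) − u^{−½}) du ∈ [0, 4e^{−2y}/y]` (`hasMellin_g`, `tail_le`, using
   `ϑ(u) − u^{−½} = u^{−½}(ϑ(1/u) − 1)` and `ϑ(v) − 1 ≤ 2e^{−πv}/(1 − e^{−πv})`).
4. Hence **`Re Λ_z(½) ≥ 2√y (γ + log y − log 4π − T'(y))`** (`re_Λ_half_ge_sharp`; compare (9):
   `= 2√y(γ + log y − log 4π) + 4θe^{−2πy}` — only the non-negative terms `m ≠ 0` of `Θ_z` were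
   dropped), and for `y ≥ 7.0556`: `γ > 0.57721558` (the tree's
   `Literature.Analysis.SpecialFunctions.Real.eulerMascheroniConstant_gt_d8`),
   `log(4π/7.0556) < 0.5772056` (`π < 3.141593`, `e^x ≥ Σ_{i<12} xⁱ/i!`) and
   `T'(y) ≤ 4e^{−14}/7 < 10^{−6}` give `Re Λ_z(½) > 0` (`re_Λ_half_pos_of_le`; the true margin is
   `γ − log(4π/7.0556) = 1.3·10^{−5}`, i.e. `4πe^{−γ} = 7.05551 < 7.0556`, exactly
   Bateman–Grosswald's rounding).
5. `re_half_pos_of_le_starkK`: for `k = √|d|/(2a) ≥ 7.0556`, `Re ζ_Q(½) > 0` for every analytic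
   continuation (apply 4 to the form `(c, b, a)`, whose point `(b + i√D)/(2a)` has imaginary part
   `k`); with `BatemanGrosswald1964_realZero_of_half_pos` (`EpsteinZetaCentralValue.lean`) this is
   `BatemanGrosswald1964_realZero_holds`.

(11) (`Z(½) < 0` for `√3/2 ≤ k ≤ 7.0554`) would need an upper bound for the dropped terms and is
not treated; neither is Stark's Theorem 1.

Reused from the tree: `Literature.NumberTheory.LFunctions.RealZeros.one_le_evenKernel_zero` (`ϑ ≥ 1`,
`LevinsonMontgomery.lean`, which treats the same Hurwitz kernel on the real axis).

## References

* [BatemanGrosswald1964] Acta Arith. 9 (1964) 365–373, Theorem 3, (9)–(10), and p. 367.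
* [MontgomeryVaughan2007] §10.1 Exercise 25 (the theta-function continuation).
-/

noncomputable section

open Complex Filter Topology MeasureTheory Set HurwitzZeta
open scoped UpperHalfPlane

namespace Literature.Barriers.RiemannHypothesis

open Literature.NumberTheory.Automorphic
open Literature.NumberTheory.LFunctions.RealZeros (one_le_evenKernel_zero)

/-! ## The one-variable theta function `ϑ(t) = Σ_n e^{-π n² t}` (Mathlib's `HurwitzZeta.evenKernel 0`) -/

/-- `ϑ(t) = Σ_{n ∈ ℤ} e^{−π n² t}` for `t > 0`. [folklore] -/
theorem evenKernel_zero_eq_tsum {t : ℝ} (ht : 0 < t) :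
    evenKernel 0 t = ∑' n : ℤ, Real.exp (-Real.pi * (n : ℝ) ^ 2 * t) := by
  have h := hasSum_int_evenKernel 0 ht
  simp only [add_zero, QuotientAddGroup.mk_zero] at h
  exact h.tsum_eq.symm

/-- `ϑ(t) − 1 = Σ_{n ≥ 1} 2e^{−π n² t}` (`t > 0`). [folklore] -/
theorem hasSum_evenKernel_zero_sub_one {t : ℝ} (ht : 0 < t) :
    HasSum (fun n : ℕ => 2 * Real.exp (-Real.pi * ((n : ℝ) + 1) ^ 2 * t)) (evenKernel 0 t - 1) := by
  have h := hasSum_nat_cosKernel₀ 0 ht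
  simp only [mul_zero, zero_mul, Real.cos_zero, mul_one, QuotientAddGroup.mk_zero] at h
  rwa [← evenKernel_eq_cosKernel_of_zero] at h

/-- **Tail bound** `ϑ(t) − 1 ≤ 2e^{−πt}/(1 − e^{−πt})` (`t > 0`; compare with the geometric
series, `(n+1)² ≥ n+1`). [folklore] -/
theorem evenKernel_zero_sub_one_le {t : ℝ} (ht : 0 < t) :
    evenKernel 0 t - 1 ≤ 2 * Real.exp (-Real.pi * t) / (1 - Real.exp (-Real.pi * t)) := by
  set q : ℝ := Real.exp (-Real.pi * t) with hq
  have hq0 : 0 < q := Real.exp_pos _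
  have hq1 : q < 1 := by
    rw [hq, Real.exp_lt_one_iff]
    have := Real.pi_pos
    nlinarith
  have hgeom : HasSum (fun n : ℕ => 2 * (q * q ^ n)) (2 * (q * (1 - q)⁻¹)) :=
    ((hasSum_geometric_of_lt_one hq0.le hq1).mul_left q).mul_left 2
  have hle : ∀ n : ℕ, 2 * Real.exp (-Real.pi * ((n : ℝ) + 1) ^ 2 * t) ≤ 2 * (q * q ^ n) := by
    intro n
    rw [hq, ← Real.exp_nat_mul, ← Real.exp_add]
    refine mul_le_mul_of_nonneg_left (Real.exp_le_exp.2 ?_) (by norm_num)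
    have hn : (0 : ℝ) ≤ n := Nat.cast_nonneg n
    have hπ := Real.pi_pos
    nlinarith [mul_nonneg hn hn, mul_pos hπ ht]
  have h := hasSum_le hle (hasSum_evenKernel_zero_sub_one ht) hgeom
  rw [div_eq_mul_inv]
  linarith

/-- `ϑ(u) = u^{-1/2} ϑ(1/u)` (`u > 0`): the theta transformation formula. [folklore] -/
theorem evenKernel_zero_functional_equation (u : ℝ) :
    evenKernel 0 u = (Real.sqrt u)⁻¹ * evenKernel 0 (1 / u) := by
  rw [evenKernel_functional_equation 0 u, ← evenKernel_eq_cosKernel_of_zero, ← Real.sqrt_eq_rpow,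
    one_div (Real.sqrt u)]

/-! ## The sub-sum over `(0, n)`: `Θ_z(t) ≥ ϑ(t/y)` -/

/-- `Θ_z(t) ≥ Σ_n e^{−π t n²/y} = ϑ(t/y)` (the terms `v = (0, n)` of the theta series of `ℤz + ℤ`).
[folklore] -/
theorem evenKernel_div_le_thetaQ (z : ℍ) {t : ℝ} (ht : 0 < t) :
    evenKernel 0 (t / z.im) ≤ thetaQ z t := by
  have hy := z.im_pos
  have hty : 0 < t / z.im := div_pos ht hy
  have hinj : Function.Injective (fun n : ℤ => (![0, n] : Fin 2 → ℤ)) := fun m n h => by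
    simpa using congrFun h 1
  have hsub := tsum_comp_le_tsum_of_inj (summable_exp_qForm z ht) (fun v => (Real.exp_pos _).le) hinj
  have hq : ∀ n : ℤ, qForm z ![0, n] = (n : ℝ) ^ 2 / z.im := fun n => by
    rw [qForm_apply]
    simp only [Matrix.cons_val_zero, Matrix.cons_val_one, Int.cast_zero, zero_mul, zero_add]
    have : z.im ≠ 0 := hy.ne'
    field_simp
    ring
  have e1 : (fun v => Real.exp (-Real.pi * t * qForm z v)) ∘ (fun n : ℤ => (![0, n] : Fin 2 → ℤ)) =
      fun n : ℤ => Real.exp (-Real.pi * (n : ℝ) ^ 2 * (t / z.im)) := by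
    funext n
    simp only [Function.comp_apply, hq]
    congr 1
    field_simp
  rw [e1, ← evenKernel_zero_eq_tsum hty] at hsub
  exact hsub


/-! ## The minorant `ℓ` of `Re f̃_z` and its Mellin transform -/

/-- **Pointwise minorant.** With `y = Im z > 1`, `ϑ = evenKernel 0` and
`g(u) = 𝟙_{(1/y,1)}(u)(ϑ(u) − 1) + 𝟙_{(1,∞)}(u)(ϑ(u) − 1)`, for every `t > 0`:
`g(t/y) + t⁻¹ g(1/(ty)) ≤ Re f̃_z(t)` (on `t > 1`: `Θ_z(t) − 1 ≥ ϑ(t/y) − 1`; on `t < 1`: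
`Θ_z(t) − 1/t = t⁻¹(Θ_z(1/t) − 1) ≥ t⁻¹(ϑ(1/(ty)) − 1)`). [folklore] -/
theorem minorant_le_re_f_modif (z : ℍ) (hy : 1 < z.im) {g : ℝ → ℝ}
    (hg : g = fun u => (Ioo (1 / z.im) 1).indicator (fun u => evenKernel 0 u - 1) u +
      (Ioi 1).indicator (fun u => evenKernel 0 u - 1) u) {t : ℝ} (ht : 0 < t) :
    g (t / z.im) + t⁻¹ * g (1 / (t * z.im)) ≤ ((thetaFEPair z).f_modif t).re := by
  set y := z.im with hydef
  have hy0 : 0 < y := by linarith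
  -- values of `g`
  have hg_le : ∀ {u : ℝ}, 0 < u → g u ≤ evenKernel 0 u - 1 := fun {u} hu => by
    have h0 : 0 ≤ evenKernel 0 u - 1 := by linarith [one_le_evenKernel_zero hu]
    have e : g u = (Ioo (1 / y) 1).indicator (fun u => evenKernel 0 u - 1) u +
        (Ioi 1).indicator (fun u => evenKernel 0 u - 1) u := by rw [hg]
    rw [e]
    by_cases h1 : u ∈ Ioo (1 / y) 1
    · have h2 : u ∉ Ioi (1 : ℝ) := fun h => lt_irrefl _ (h1.2.trans h)
      rw [indicator_of_mem h1, indicator_of_notMem h2, add_zero]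
    · by_cases h2 : u ∈ Ioi (1 : ℝ)
      · rw [indicator_of_notMem h1, indicator_of_mem h2, zero_add]
      · rw [indicator_of_notMem h1, indicator_of_notMem h2, add_zero]
        exact h0
  have hg_zero : ∀ {u : ℝ}, u ≤ 1 → u ∉ Ioo (1 / y) 1 → g u = 0 := fun {u} hu h1 => by
    have h2 : u ∉ Ioi (1 : ℝ) := fun h => not_le.2 h hu
    have e : g u = (Ioo (1 / y) 1).indicator (fun u => evenKernel 0 u - 1) u +
        (Ioi 1).indicator (fun u => evenKernel 0 u - 1) u := by rw [hg]
    rw [e, indicator_of_notMem h1, indicator_of_notMem h2, add_zero]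
  rcases lt_trichotomy t 1 with h | rfl | h
  · -- `t < 1`: the first term vanishes, the second is `≤ Θ_z(t) − 1/t`
    have hty : t / y ≤ 1 := by rw [div_le_one hy0]; linarith
    have h1 : t / y ∉ Ioo (1 / y) 1 := fun hm => by
      have := hm.1; rw [div_lt_div_iff_of_pos_right hy0] at this; linarith
    rw [hg_zero hty h1, zero_add, re_f_modif_of_mem_Ioo z ⟨ht, h⟩, thetaQ_eq_inv_mul z ht]
    have hit : 0 < 1 / t := one_div_pos.2 ht
    have hb := evenKernel_div_le_thetaQ z hit
    rw [show 1 / t / y = 1 / (t * y) by rw [div_div]] at hb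
    have hgle := hg_le (u := 1 / (t * y)) (by positivity)
    have hti : 0 < t⁻¹ := inv_pos.2 ht
    nlinarith
  · -- `t = 1`
    simp only [one_mul, inv_one, WeakFEPair.f_modif, thetaFEPair, Pi.add_apply, mem_Ioi,
      lt_self_iff_false, not_false_eq_true, indicator_of_notMem, mem_Ioo, zero_lt_one, and_false,
      add_zero, Complex.zero_re]
    have h1 : (1 : ℝ) / y ∉ Ioo (1 / y) 1 := fun hm => lt_irrefl _ hm.1
    rw [hg_zero (le_of_lt (by rw [div_lt_one hy0]; exact hy)) h1]
    simp
  · -- `t > 1`: the second term vanishes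
    have hity : 1 / (t * y) ≤ 1 := by
      rw [div_le_one (by positivity)]; nlinarith
    have h1 : 1 / (t * y) ∉ Ioo (1 / y) 1 := fun hm => by
      have := hm.1
      rw [div_lt_div_iff_of_pos_left one_pos hy0 (by positivity)] at this
      nlinarith
    rw [hg_zero hity h1, mul_zero, add_zero, re_f_modif_of_one_lt z h]
    linarith [hg_le (u := t / y) (by positivity), evenKernel_div_le_thetaQ z ht]

/-- Mellin bookkeeping I: `∫₀^∞ t^{s-1} t⁻¹ f(1/t) dt = ∫₀^∞ t^{-s} f(t) dt`, i.e. at `s = ½` the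
reflected piece has the same Mellin transform. [folklore] -/
theorem mellin_inv_mul_comp_inv (f : ℝ → ℂ) :
    mellin (fun t : ℝ => ((t⁻¹ : ℝ) : ℂ) * f t⁻¹) (1 / 2) = mellin f (1 / 2) := by
  have e : (fun t : ℝ => ((t⁻¹ : ℝ) : ℂ) * f t⁻¹) = fun t : ℝ => (t : ℂ) ^ (-1 : ℂ) • (fun u => f u⁻¹) t := by
    funext t
    rw [Complex.cpow_neg_one, smul_eq_mul, Complex.ofReal_inv]
  rw [e, mellin_cpow_smul, mellin_comp_inv]
  norm_num

/-- Mellin bookkeeping II: `mellin (t ↦ f(t/y)) (½) = √y · mellin f (½)`. [folklore] -/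
theorem mellin_comp_inv_mul (f : ℝ → ℂ) {y : ℝ} (hy : 0 < y) :
    mellin (fun t : ℝ => f (y⁻¹ * t)) (1 / 2) = (Real.sqrt y : ℂ) * mellin f (1 / 2) := by
  rw [mellin_comp_mul_left f (1 / 2) (inv_pos.2 hy), smul_eq_mul]
  congr 1
  rw [show (-(1 / 2) : ℂ) = ((-(1 / 2) : ℝ) : ℂ) by push_cast; ring, ← Complex.ofReal_cpow (inv_pos.2 hy).le,
    Real.inv_rpow hy.le, Real.rpow_neg hy.le, inv_inv, Real.sqrt_eq_rpow]


/-! ## The Hurwitz (Riemann) theta pair at `s = ½`: `Λ₀^H(½) = 2 + γ − log 4π` -/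

/-- The explicit form of `f̃^H = f_modif` for Mathlib's even Hurwitz pair at `a = 0`:
`𝟙_{(1,∞)}(ϑ − 1) + 𝟙_{(0,1)}(ϑ(x) − x^{−1/2})`. [folklore] -/
theorem f_modif_hurwitz_zero (x : ℝ) : (hurwitzEvenFEPair 0).f_modif x =
    (Ioi 1).indicator (fun x : ℝ => (((evenKernel 0 x - 1 : ℝ)) : ℂ)) x +
      (Ioo 0 1).indicator (fun x : ℝ => ((evenKernel 0 x - x ^ (-(1 / 2 : ℝ)) : ℝ) : ℂ)) x := by
  rw [WeakFEPair.f_modif]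
  simp only [hurwitzEvenFEPair, Pi.add_apply, if_true, Function.comp_apply, one_mul, smul_eq_mul,
    mul_one]
  congr 1
  · refine congrFun (Set.indicator_congr fun u _ => ?_) x
    push_cast; ring
  · refine congrFun (Set.indicator_congr fun u _ => ?_) x
    push_cast
    norm_num

/-- **`mellin f̃^H (½) = Λ₀^H(½) = 2·completedRiemannZeta₀(1)`** (Mathlib's normalisation
`completedRiemannZeta₀ s = Λ₀^H(s/2)/2`). [folklore] -/
theorem mellin_f_modif_hurwitz_half :
    mellin (hurwitzEvenFEPair 0).f_modif (1 / 2) = 2 * completedRiemannZeta₀ 1 := by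
  rw [show completedRiemannZeta₀ 1 = (hurwitzEvenFEPair 0).Λ₀ (1 / 2) / 2 from rfl, WeakFEPair.Λ₀]
  ring

/-- **`Re Λ₀^H(½) = 2 + γ − log 4π`**, from Mathlib's `completedRiemannZeta₀_one`
(`completedRiemannZeta₀ 1 = (γ − log 4π)/2 + 1`). [folklore] -/
theorem re_two_mul_completedRiemannZeta₀_one :
    (2 * completedRiemannZeta₀ 1).re = 2 + Real.eulerMascheroniConstant - Real.log (4 * Real.pi) := by
  rw [completedRiemannZeta₀_one]
  have h4π : (0 : ℝ) ≤ 4 * Real.pi := by positivity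
  rw [show (4 : ℂ) * (Real.pi : ℂ) = ((4 * Real.pi : ℝ) : ℂ) by push_cast; ring, ← Complex.ofReal_log h4π]
  simp only [Complex.mul_re, Complex.re_ofNat, Complex.add_re, Complex.div_ofNat_re, Complex.sub_re,
    Complex.ofReal_re, Complex.one_re, Complex.im_ofNat, Complex.add_im, Complex.div_ofNat_im,
    Complex.sub_im, Complex.ofReal_im, Complex.one_im]
  ring

/-- `∫_{1/y}^1 (u⁻¹ − u^{−1/2}) du = log y − 2 + 2/√y` (`y ≥ 1`). [folklore] -/
theorem integral_inv_sub_rpow {y : ℝ} (hy : 1 ≤ y) :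
    ∫ u in (1 / y : ℝ)..1, (u⁻¹ - u ^ (-(1 / 2 : ℝ))) = Real.log y - 2 + 2 / Real.sqrt y := by
  have hy0 : 0 < y := by linarith
  have hiy : 0 < 1 / y := one_div_pos.2 hy0
  have hiy1 : 1 / y ≤ 1 := by rw [div_le_one hy0]; exact hy
  have hmem : ∀ t ∈ uIcc (1 / y : ℝ) 1, 0 < t := fun t ht => by
    rw [uIcc_of_le hiy1] at ht; linarith [ht.1]
  have hc1 : ContinuousOn (fun t : ℝ => t⁻¹) (uIcc (1 / y) 1) :=
    continuousOn_inv₀.mono fun t ht => (hmem t ht).ne'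
  have hc2 : ContinuousOn (fun t : ℝ => t ^ (-(1 / 2 : ℝ))) (uIcc (1 / y) 1) :=
    ContinuousOn.rpow_const continuousOn_id fun t ht => Or.inl (hmem t ht).ne'
  rw [intervalIntegral.integral_sub hc1.intervalIntegrable hc2.intervalIntegrable,
    integral_inv_of_pos hiy one_pos, one_div_one_div, integral_rpow (Or.inl (by norm_num)),
    Real.one_rpow, show -(1 / 2 : ℝ) + 1 = 1 / 2 by norm_num, one_div y,
    Real.inv_rpow hy0.le, ← Real.sqrt_eq_rpow]
  field_simp
  ring


/-! ## The Mellin transform of `g = 𝟙_{(1/y,1)}(ϑ − 1) + 𝟙_{(1,∞)}(ϑ − 1)` at `½` -/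

/-- The difference `g − f̃^H`, weighted by `u^{−1/2}`, is the explicit real function
`d = 𝟙_{(1/y,1)}(u⁻¹ − u^{−1/2}) − 𝟙_{(0,1/y]} u^{−1/2}(ϑ(u) − u^{−1/2})` on `(0, ∞)`. [folklore] -/
theorem cpow_smul_g_sub_f_modif {y : ℝ} (hy : 1 < y) {g : ℝ → ℝ}
    (hg : g = fun u => (Ioo (1 / y) 1).indicator (fun u => evenKernel 0 u - 1) u +
      (Ioi 1).indicator (fun u => evenKernel 0 u - 1) u) {u : ℝ} (hu : 0 < u) :
    (u : ℂ) ^ ((1 / 2 : ℂ) - 1) • (((g u : ℝ) : ℂ) - (hurwitzEvenFEPair 0).f_modif u) =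
      (((Ioo (1 / y) 1).indicator (fun u : ℝ => u⁻¹ - u ^ (-(1 / 2 : ℝ))) u -
        (Ioc 0 (1 / y)).indicator
          (fun u : ℝ => u ^ (-(1 / 2 : ℝ)) * (evenKernel 0 u - u ^ (-(1 / 2 : ℝ)))) u : ℝ) : ℂ) := by
  have hy0 : 0 < y := by linarith
  have hiy1 : 1 / y < 1 := by rw [div_lt_one hy0]; exact hy
  have hpow : (u : ℂ) ^ ((1 / 2 : ℂ) - 1) = ((u ^ (-(1 / 2 : ℝ)) : ℝ) : ℂ) := by
    rw [show (1 / 2 : ℂ) - 1 = ((-(1 / 2 : ℝ) : ℝ) : ℂ) by push_cast; ring, Complex.ofReal_cpow hu.le]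
  have hsq : u ^ (-(1 / 2 : ℝ)) * u ^ (-(1 / 2 : ℝ)) = u⁻¹ := by
    rw [← Real.rpow_add hu, ← Real.rpow_neg_one]; norm_num
  have eg : g u = (Ioo (1 / y) 1).indicator (fun u => evenKernel 0 u - 1) u +
      (Ioi 1).indicator (fun u => evenKernel 0 u - 1) u := by rw [hg]
  rw [hpow, f_modif_hurwitz_zero, smul_eq_mul, eg]
  by_cases hA : u ∈ Ioc 0 (1 / y)
  · have h1 : u ∉ Ioo (1 / y) 1 := fun h => not_lt.2 hA.2 h.1
    have h2 : u ∉ Ioi (1 : ℝ) := fun h => by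
      have := hA.2; exact absurd (lt_trans hiy1 h) (not_lt.2 this)
    have h3 : u ∈ Ioo (0 : ℝ) 1 := ⟨hu, lt_of_le_of_lt hA.2 hiy1⟩
    rw [indicator_of_notMem h1, indicator_of_notMem h2, indicator_of_notMem h2, indicator_of_mem h3,
      indicator_of_notMem h1, indicator_of_mem hA]
    push_cast
    ring
  · by_cases hB : u ∈ Ioo (1 / y) 1
    · have h2 : u ∉ Ioi (1 : ℝ) := fun h => lt_irrefl _ (hB.2.trans h)
      have h3 : u ∈ Ioo (0 : ℝ) 1 := ⟨hu, hB.2⟩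
      rw [indicator_of_mem hB, indicator_of_notMem h2, indicator_of_notMem h2, indicator_of_mem h3,
        indicator_of_mem hB, indicator_of_notMem hA]
      have hsqC : ((u ^ (-(1 / 2 : ℝ)) : ℝ) : ℂ) * ((u ^ (-(1 / 2 : ℝ)) : ℝ) : ℂ) = ((u : ℂ))⁻¹ := by
        rw [← Complex.ofReal_mul, hsq, Complex.ofReal_inv]
      push_cast
      linear_combination hsqC
    · -- `u ≥ 1`
      have hu1 : 1 ≤ u := by
        by_contra h
        have h' := lt_of_not_ge h
        rcases le_or_gt u (1 / y) with h'' | h''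
        · exact hA ⟨hu, h''⟩
        · exact hB ⟨h'', h'⟩
      have h3 : u ∉ Ioo (0 : ℝ) 1 := fun h => not_lt.2 hu1 h.2
      rw [indicator_of_notMem hB, indicator_of_notMem h3, indicator_of_notMem hB, indicator_of_notMem hA]
      rcases eq_or_lt_of_le hu1 with h | h
      · subst h
        simp
      · rw [indicator_of_mem (mem_Ioi.2 h), indicator_of_mem (mem_Ioi.2 h)]
        push_cast
        ring

/-- The tail integral `T'(y) = ∫_{(0,1/y]} u^{−1/2}(ϑ(u) − u^{−1/2}) du`: its integrand is integrable
(it is the Mellin integrand of `f̃^H` there) and non-negative (`ϑ(u) ≥ u^{−1/2}`). [folklore] -/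
theorem integrableOn_tail {y : ℝ} (hy : 1 < y) :
    IntegrableOn (fun u : ℝ => u ^ (-(1 / 2 : ℝ)) * (evenKernel 0 u - u ^ (-(1 / 2 : ℝ))))
      (Ioc 0 (1 / y)) := by
  have hy0 : 0 < y := by linarith
  have hiy1 : 1 / y < 1 := by rw [div_lt_one hy0]; exact hy
  have hconv : MellinConvergent (hurwitzEvenFEPair 0).f_modif (1 / 2) :=
    ((hurwitzEvenFEPair 0).isStrongFEPair_toStrongFEPair.hasMellin (1 / 2)).1
  have h : IntegrableOn (fun t : ℝ => Complex.reCLM (((t : ℂ) ^ ((1 / 2 : ℂ) - 1)) •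
      (hurwitzEvenFEPair 0).f_modif t)) (Ioi 0) := Complex.reCLM.integrable_comp hconv
  refine (h.mono_set Ioc_subset_Ioi_self).congr_fun (fun u hu => ?_) measurableSet_Ioc
  have hu0 : 0 < u := hu.1
  have h3 : u ∈ Ioo (0 : ℝ) 1 := ⟨hu0, lt_of_le_of_lt hu.2 hiy1⟩
  have h2 : u ∉ Ioi (1 : ℝ) := fun h' => lt_irrefl _ ((lt_of_le_of_lt hu.2 hiy1).trans h')
  simp only [Complex.reCLM_apply]
  rw [show (1 / 2 : ℂ) - 1 = ((-(1 / 2 : ℝ) : ℝ) : ℂ) by push_cast; ring, ← Complex.ofReal_cpow hu0.le,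
    f_modif_hurwitz_zero, indicator_of_notMem h2, indicator_of_mem h3, zero_add, smul_eq_mul,
    ← Complex.ofReal_mul, Complex.ofReal_re]

/-- `ϑ(u) − u^{−1/2} = u^{−1/2}(ϑ(1/u) − 1) ≥ 0`. [folklore] -/
theorem evenKernel_sub_rpow_eq {u : ℝ} (hu : 0 < u) :
    evenKernel 0 u - u ^ (-(1 / 2 : ℝ)) = u ^ (-(1 / 2 : ℝ)) * (evenKernel 0 (1 / u) - 1) := by
  rw [evenKernel_zero_functional_equation u, Real.sqrt_eq_rpow, ← Real.rpow_neg hu.le]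
  ring

/-- The tail integrand is non-negative. [folklore] -/
theorem tail_nonneg {u : ℝ} (hu : 0 < u) :
    0 ≤ u ^ (-(1 / 2 : ℝ)) * (evenKernel 0 u - u ^ (-(1 / 2 : ℝ))) := by
  rw [evenKernel_sub_rpow_eq hu]
  have h1 := one_le_evenKernel_zero (one_div_pos.2 hu)
  have h2 : 0 ≤ u ^ (-(1 / 2 : ℝ)) := Real.rpow_nonneg hu.le _
  exact mul_nonneg h2 (mul_nonneg h2 (by linarith))

/-- **The Mellin transform of `g` at `½`**:
`mellin g (½) = 2·completedRiemannZeta₀(1) + (log y − 2 + 2/√y) − T'(y)`, and it converges.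
[folklore] -/
theorem hasMellin_g {y : ℝ} (hy : 1 < y) {g : ℝ → ℝ}
    (hg : g = fun u => (Ioo (1 / y) 1).indicator (fun u => evenKernel 0 u - 1) u +
      (Ioi 1).indicator (fun u => evenKernel 0 u - 1) u) :
    HasMellin (fun u => ((g u : ℝ) : ℂ)) (1 / 2)
      (2 * completedRiemannZeta₀ 1 + ((Real.log y - 2 + 2 / Real.sqrt y : ℝ) : ℂ) -
        ((∫ u in Ioc 0 (1 / y), u ^ (-(1 / 2 : ℝ)) * (evenKernel 0 u - u ^ (-(1 / 2 : ℝ))) : ℝ) : ℂ)) := by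
  have hy0 : 0 < y := by linarith
  have hiy : 0 < 1 / y := one_div_pos.2 hy0
  have hiy1 : 1 / y < 1 := by rw [div_lt_one hy0]; exact hy
  set P := hurwitzEvenFEPair 0 with hP
  have hconv : MellinConvergent P.f_modif (1 / 2) := (P.isStrongFEPair_toStrongFEPair.hasMellin (1 / 2)).1
  -- the difference `D = g − f̃^H` and its (real, explicit) weighted form `d`
  set D : ℝ → ℂ := fun u => ((g u : ℝ) : ℂ) - P.f_modif u with hD
  set d : ℝ → ℝ := fun u => (Ioo (1 / y) 1).indicator (fun u : ℝ => u⁻¹ - u ^ (-(1 / 2 : ℝ))) u -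
    (Ioc 0 (1 / y)).indicator (fun u : ℝ => u ^ (-(1 / 2 : ℝ)) * (evenKernel 0 u - u ^ (-(1 / 2 : ℝ)))) u
    with hd
  have hDd : ∀ u ∈ Ioi (0 : ℝ), (u : ℂ) ^ ((1 / 2 : ℂ) - 1) • D u = ((d u : ℝ) : ℂ) :=
    fun u hu => cpow_smul_g_sub_f_modif hy hg hu
  -- integrability of `d`
  have hpos : ∀ t ∈ Icc (1 / y) 1, (0 : ℝ) < t := fun t ht => lt_of_lt_of_le hiy ht.1
  have hcA : ContinuousOn (fun u : ℝ => u⁻¹ - u ^ (-(1 / 2 : ℝ))) (Icc (1 / y) 1) :=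
    (continuousOn_inv₀.mono fun t ht => (hpos t ht).ne').sub
      (ContinuousOn.rpow_const continuousOn_id fun t ht => Or.inl (hpos t ht).ne')
  have hiA : IntegrableOn (fun u : ℝ => u⁻¹ - u ^ (-(1 / 2 : ℝ))) (Ioo (1 / y) 1) :=
    (hcA.integrableOn_Icc).mono_set Ioo_subset_Icc_self
  have hIA : Integrable ((Ioo (1 / y) 1).indicator fun u : ℝ => u⁻¹ - u ^ (-(1 / 2 : ℝ))) :=
    (integrable_indicator_iff measurableSet_Ioo).2 hiA
  have hIB : Integrable ((Ioc 0 (1 / y)).indicator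
      fun u : ℝ => u ^ (-(1 / 2 : ℝ)) * (evenKernel 0 u - u ^ (-(1 / 2 : ℝ)))) :=
    (integrable_indicator_iff measurableSet_Ioc).2 (integrableOn_tail hy)
  have hdint : Integrable d := hIA.sub hIB
  -- hence `D` is Mellin-convergent at `½`, with transform `∫ d`
  have hDconv : MellinConvergent D (1 / 2) := by
    have h1 : IntegrableOn (fun u : ℝ => ((d u : ℝ) : ℂ)) (Ioi 0) := hdint.ofReal.integrableOn
    exact h1.congr_fun (fun u hu => (hDd u hu).symm) measurableSet_Ioi
  have hDmellin : mellin D (1 / 2) = ((∫ u in Ioi (0 : ℝ), d u : ℝ) : ℂ) := by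
    unfold mellin
    rw [setIntegral_congr_fun measurableSet_Ioi hDd]
    exact integral_ofReal
  have hdval : ∫ u in Ioi (0 : ℝ), d u = (Real.log y - 2 + 2 / Real.sqrt y) -
      ∫ u in Ioc 0 (1 / y), u ^ (-(1 / 2 : ℝ)) * (evenKernel 0 u - u ^ (-(1 / 2 : ℝ))) := by
    simp only [hd]
    rw [integral_sub hIA.integrableOn hIB.integrableOn, setIntegral_indicator measurableSet_Ioo,
      setIntegral_indicator measurableSet_Ioc,
      show Ioi (0 : ℝ) ∩ Ioo (1 / y) 1 = Ioo (1 / y) 1 from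
        inter_eq_right.2 fun t ht => lt_trans hiy ht.1,
      show Ioi (0 : ℝ) ∩ Ioc 0 (1 / y) = Ioc 0 (1 / y) from inter_eq_right.2 fun t ht => ht.1,
      ← integral_Ioc_eq_integral_Ioo, ← intervalIntegral.integral_of_le hiy1.le,
      integral_inv_sub_rpow hy.le]
  -- assemble: `g = f̃^H + D`
  have hsum := hasMellin_add hconv hDconv
  have e : (fun t => P.f_modif t + D t) = fun u => ((g u : ℝ) : ℂ) := by
    funext u; simp only [hD]; ring
  rw [e] at hsum
  refine ⟨hsum.1, ?_⟩
  rw [hsum.2, hDmellin, hdval, show mellin P.f_modif (1 / 2) = 2 * completedRiemannZeta₀ 1 from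
    mellin_f_modif_hurwitz_half]
  push_cast
  ring


/-! ## The sharp lower bound `Re Λ_z(½) ≥ 2√y (γ + log y − log 4π − T'(y))` -/

/-- **The central value, sharp form.** For `y = Im z > 1`,
`Re Λ_z(½) ≥ 2√y (γ + log y − log 4π) − 2√y T'(y)` with the tail
`T'(y) = ∫_{(0,1/y]} u^{−1/2}(ϑ(u) − u^{−1/2}) du` (`= ∫_y^∞ (ϑ(v) − 1) dv/v`, exponentially small).
Compare Bateman–Grosswald (9): `Λ_z(½) = 2√k (γ + log k − log 4π) + 4θe^{−2πk}`; here only the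
non-negative theta terms with `m ≠ 0` are dropped, the one-variable theta integrals being evaluated
EXACTLY through Mathlib's `completedRiemannZeta₀_one` (`Λ₀^H(½) = 2 + γ − log 4π`).
[cite: BatemanGrosswald1964, Theorem 3 (9)] -/
theorem re_Λ_half_ge_sharp (z : ℍ) (hy : 1 < z.im) :
    2 * Real.sqrt z.im * (Real.eulerMascheroniConstant + Real.log z.im - Real.log (4 * Real.pi)) -
      2 * Real.sqrt z.im *
        (∫ u in Ioc 0 (1 / z.im), u ^ (-(1 / 2 : ℝ)) * (evenKernel 0 u - u ^ (-(1 / 2 : ℝ)))) ≤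
      ((thetaFEPair z).Λ ((1 / 2 : ℝ) : ℂ)).re := by
  set y := z.im with hydef
  have hy0 : 0 < y := by linarith
  have hsy : 0 < Real.sqrt y := Real.sqrt_pos.2 hy0
  set T : ℝ := ∫ u in Ioc 0 (1 / y), u ^ (-(1 / 2 : ℝ)) * (evenKernel 0 u - u ^ (-(1 / 2 : ℝ))) with hT
  -- the minorant and its pieces
  set g : ℝ → ℝ := fun u => (Ioo (1 / y) 1).indicator (fun u => evenKernel 0 u - 1) u +
    (Ioi 1).indicator (fun u => evenKernel 0 u - 1) u with hg
  set G : ℝ → ℂ := fun u => ((g u : ℝ) : ℂ) with hG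
  set L₁ : ℝ → ℂ := fun t => G (y⁻¹ * t) with hL₁
  set P₂ : ℝ → ℂ := fun t => ((t⁻¹ : ℝ) : ℂ) * L₁ t⁻¹ with hP₂
  set V : ℂ := 2 * completedRiemannZeta₀ 1 + ((Real.log y - 2 + 2 / Real.sqrt y : ℝ) : ℂ) - (T : ℂ)
    with hV
  have hGm : HasMellin G (1 / 2) V := hasMellin_g hy hg
  -- Mellin transforms of the pieces
  have hL₁conv : MellinConvergent L₁ (1 / 2) := (MellinConvergent.comp_mul_left (inv_pos.2 hy0)).2 hGm.1
  have hL₁m : mellin L₁ (1 / 2) = (Real.sqrt y : ℂ) * V := by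
    rw [hL₁, mellin_comp_inv_mul G hy0, hGm.2]
  have hP₂conv : MellinConvergent P₂ (1 / 2) := by
    have e : P₂ = fun t : ℝ => (t : ℂ) ^ (-1 : ℂ) • (fun u => L₁ (u ^ (-1 : ℝ))) t := by
      funext t
      simp only [hP₂]
      rw [Complex.cpow_neg_one, smul_eq_mul, Complex.ofReal_inv, Real.rpow_neg_one]
    rw [e, MellinConvergent.cpow_smul, MellinConvergent.comp_rpow (by norm_num : (-1 : ℝ) ≠ 0)]
    have h12 : ((1 : ℂ) / 2 + -1) / ((-1 : ℝ) : ℂ) = 1 / 2 := by push_cast; norm_num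
    rw [h12]
    exact hL₁conv
  have hP₂m : mellin P₂ (1 / 2) = mellin L₁ (1 / 2) := mellin_inv_mul_comp_inv L₁
  have hℓ := hasMellin_add hL₁conv hP₂conv
  -- comparison of real integrals
  have hmono : ∫ t in Ioi (0 : ℝ), (((t : ℂ) ^ ((1 / 2 : ℂ) - 1)) • (L₁ t + P₂ t)).re ≤
      ∫ t in Ioi (0 : ℝ), t ^ ((1 / 2 : ℝ) - 1) * ((thetaFEPair z).f_modif t).re := by
    refine setIntegral_mono_on ?_ (integrableOn_re_integrand z (1 / 2)) measurableSet_Ioi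
      fun t ht => ?_
    · have h : IntegrableOn (fun t : ℝ => Complex.reCLM (((t : ℂ) ^ ((1 / 2 : ℂ) - 1)) •
          (L₁ t + P₂ t))) (Ioi 0) := Complex.reCLM.integrable_comp hℓ.1
      exact h
    · have ht0 : (0 : ℝ) < t := ht
      have hpow : (t : ℂ) ^ ((1 / 2 : ℂ) - 1) = ((t ^ ((1 / 2 : ℝ) - 1) : ℝ) : ℂ) := by
        rw [show (1 / 2 : ℂ) - 1 = (((1 / 2 : ℝ) - 1 : ℝ) : ℂ) by push_cast; ring,
          Complex.ofReal_cpow ht0.le]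
      have hreal : (((t : ℂ) ^ ((1 / 2 : ℂ) - 1)) • (L₁ t + P₂ t)).re =
          t ^ ((1 / 2 : ℝ) - 1) * (g (t / y) + t⁻¹ * g (1 / (t * y))) := by
        rw [hpow, smul_eq_mul]
        simp only [hL₁, hP₂, hG]
        rw [show y⁻¹ * t = t / y by rw [div_eq_inv_mul],
          show y⁻¹ * t⁻¹ = 1 / (t * y) by rw [one_div, mul_inv, mul_comm]]
        norm_cast
      rw [hreal]
      exact mul_le_mul_of_nonneg_left (minorant_le_re_f_modif z hy hg ht0)
        (Real.rpow_nonneg ht0.le _)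
  -- evaluate the left side
  have hleft : ∫ t in Ioi (0 : ℝ), (((t : ℂ) ^ ((1 / 2 : ℂ) - 1)) • (L₁ t + P₂ t)).re =
      2 * Real.sqrt y * (2 + Real.eulerMascheroniConstant - Real.log (4 * Real.pi) +
        (Real.log y - 2 + 2 / Real.sqrt y) - T) := by
    have h1 : ∫ t in Ioi (0 : ℝ), (((t : ℂ) ^ ((1 / 2 : ℂ) - 1)) • (L₁ t + P₂ t)).re =
        (mellin (fun t => L₁ t + P₂ t) (1 / 2)).re := by
      unfold mellin
      rw [← Complex.reCLM_apply (∫ t in Ioi (0:ℝ), _), ← ContinuousLinearMap.integral_comp_comm _ hℓ.1]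
      rfl
    rw [h1, hℓ.2, hP₂m, hL₁m, ← two_mul, hV]
    have e2 : (2 : ℂ) * ((Real.sqrt y : ℂ) * (2 * completedRiemannZeta₀ 1 +
        ((Real.log y - 2 + 2 / Real.sqrt y : ℝ) : ℂ) - (T : ℂ))) =
        ((2 * Real.sqrt y : ℝ) : ℂ) * (2 * completedRiemannZeta₀ 1 +
          ((Real.log y - 2 + 2 / Real.sqrt y : ℝ) : ℂ) - (T : ℂ)) := by
      push_cast; ring
    rw [e2, Complex.re_ofReal_mul, Complex.sub_re, Complex.add_re, re_two_mul_completedRiemannZeta₀_one,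
      Complex.ofReal_re, Complex.ofReal_re]
  -- conclude
  have key : 2 * Real.sqrt y * (2 + Real.eulerMascheroniConstant - Real.log (4 * Real.pi) +
      (Real.log y - 2 + 2 / Real.sqrt y) - T) =
      2 * Real.sqrt y * (Real.eulerMascheroniConstant + Real.log y - Real.log (4 * Real.pi)) -
        2 * Real.sqrt y * T + 4 := by
    field_simp
    ring
  rw [re_Λ_ofReal, re_Λ₀_eq_integral]
  norm_num
  rw [hleft] at hmono
  linarith


/-! ## The tail `T'(y) ≤ 4e^{−2y}/y` -/

/-- `e^{−π} ≤ 1/4` (`e^π ≥ 1 + π > 4`). [folklore] -/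
theorem exp_neg_pi_le : Real.exp (-Real.pi) ≤ 1 / 4 := by
  have h := Real.add_one_le_exp Real.pi
  have hπ := Real.pi_gt_three
  rw [Real.exp_neg, inv_eq_one_div, div_le_div_iff₀ (Real.exp_pos _) (by norm_num : (0:ℝ) < 4)]
  linarith

/-- Pointwise bound for the tail integrand on `(0, 1/y]`, `y > 1`:
`u^{−1/2}(ϑ(u) − u^{−1/2}) = u⁻¹(ϑ(1/u) − 1) ≤ 4u⁻¹e^{−π/u} ≤ 4e^{−2/u} ≤ 4e^{−2y}`. [folklore] -/
theorem tail_integrand_le {y : ℝ} (hy : 1 < y) {u : ℝ} (hu : u ∈ Ioc 0 (1 / y)) :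
    u ^ (-(1 / 2 : ℝ)) * (evenKernel 0 u - u ^ (-(1 / 2 : ℝ))) ≤ 4 * Real.exp (-2 * y) := by
  have hy0 : 0 < y := by linarith
  have hu0 : 0 < u := hu.1
  set v : ℝ := 1 / u with hv
  have hv0 : 0 < v := one_div_pos.2 hu0
  have hyv : y ≤ v := by
    rw [hv, le_one_div hy0 hu0]; exact hu.2
  have hv1 : 1 < v := lt_of_lt_of_le hy hyv
  -- `u^{-1/2} (ϑ u - u^{-1/2}) = v (ϑ v' - 1)` with `v = 1/u`
  have hsq : u ^ (-(1 / 2 : ℝ)) * u ^ (-(1 / 2 : ℝ)) = v := by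
    rw [← Real.rpow_add hu0, hv, one_div, ← Real.rpow_neg_one]
    norm_num
    exact Real.rpow_neg_one u
  rw [evenKernel_sub_rpow_eq hu0, ← mul_assoc, hsq]
  -- `ϑ(v) − 1 ≤ 2q/(1−q) ≤ 4q`, `q = e^{−πv} ≤ e^{−π} ≤ 1/4`
  have hq := evenKernel_zero_sub_one_le hv0
  set q : ℝ := Real.exp (-Real.pi * v) with hqdef
  have hq0 : 0 < q := Real.exp_pos _
  have hqle : q ≤ 1 / 4 := by
    refine le_trans (Real.exp_le_exp.2 ?_) exp_neg_pi_le
    have := Real.pi_pos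
    nlinarith
  have h1q : 1 / 2 ≤ 1 - q := by linarith
  have hθ : evenKernel 0 (1 / u) - 1 ≤ 4 * q := by
    rw [← hv]
    refine hq.trans ?_
    rw [div_le_iff₀ (by linarith)]
    nlinarith
  -- `v q = v e^{−πv} ≤ e^{−2v} ≤ e^{−2y}`
  have hvexp : v * q ≤ Real.exp (-2 * v) := by
    have h2 : v ≤ Real.exp ((Real.pi - 2) * v) := by
      have h3 := Real.add_one_le_exp ((Real.pi - 2) * v)
      have hπ := Real.pi_gt_three
      nlinarith
    have e : Real.exp (-2 * v) = Real.exp ((Real.pi - 2) * v) * q := by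
      rw [hqdef, ← Real.exp_add]; ring_nf
    rw [e]
    exact mul_le_mul_of_nonneg_right h2 hq0.le
  have hmono : Real.exp (-2 * v) ≤ Real.exp (-2 * y) := Real.exp_le_exp.2 (by linarith)
  calc v * (evenKernel 0 (1 / u) - 1) ≤ v * (4 * q) := mul_le_mul_of_nonneg_left hθ hv0.le
    _ = 4 * (v * q) := by ring
    _ ≤ 4 * Real.exp (-2 * y) := by linarith [hvexp.trans hmono]

/-- **Tail bound** `0 ≤ T'(y) ≤ 4e^{−2y}/y` (`y > 1`). [folklore] -/
theorem tail_le {y : ℝ} (hy : 1 < y) :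
    ∫ u in Ioc 0 (1 / y), u ^ (-(1 / 2 : ℝ)) * (evenKernel 0 u - u ^ (-(1 / 2 : ℝ))) ≤
      4 * Real.exp (-2 * y) / y := by
  have hy0 : 0 < y := by linarith
  have hiy : 0 ≤ 1 / y := (one_div_pos.2 hy0).le
  have hconst : IntegrableOn (fun _ : ℝ => 4 * Real.exp (-2 * y)) (Ioc 0 (1 / y)) :=
    integrableOn_const (by simp)
  have h := setIntegral_mono_on (integrableOn_tail hy) hconst measurableSet_Ioc
    fun u hu => tail_integrand_le hy hu
  refine h.trans (le_of_eq ?_)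
  rw [setIntegral_const, Real.volume_real_Ioc_of_le hiy, sub_zero, smul_eq_mul]
  ring

/-! ## Numerics: `γ + log 7.0556 − log 4π > 10⁻⁶ > 4e^{−14}/7` -/

/-- `log(4π/7.0556) < 0.5772056` (from `π < 3.141593` and `e^x ≥ Σ_{i<12} xⁱ/i!`; the true value
is `0.5772026…`, and `γ = 0.5772156…`). [folklore] -/
theorem log_four_pi_sub_log_lt : Real.log (4 * Real.pi) - Real.log 7.0556 < 0.5772056 := by
  have hπ := Real.pi_lt_d6
  have hπ0 := Real.pi_pos
  have h1 : (4 * 3.141593 / 7.0556 : ℝ) ≤ ∑ i ∈ Finset.range 12, (0.5772056 : ℝ) ^ i / i.factorial := by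
    norm_num [Finset.sum_range_succ, Nat.factorial]
  have h2 := Real.sum_le_exp_of_nonneg (by norm_num : (0 : ℝ) ≤ 0.5772056) 12
  have h3 : 4 * Real.pi / 7.0556 < Real.exp 0.5772056 := by
    refine lt_of_lt_of_le ?_ (h1.trans h2)
    rw [div_lt_div_iff_of_pos_right (by norm_num)]
    linarith
  rw [← Real.log_div (by positivity) (by norm_num), Real.log_lt_iff_lt_exp (by positivity)]
  exact h3

/-- `4e^{−14}/7 < 10⁻⁶` (`e > 2.718281828`). [folklore] -/
theorem four_mul_exp_neg_fourteen_lt : 4 * Real.exp (-2 * 7) / 7 < (0.000001 : ℝ) := by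
  have he := Real.exp_one_gt_d9
  have h14 : (2.7182818283 : ℝ) ^ 14 < Real.exp 14 := by
    rw [show (14 : ℝ) = (14 : ℕ) * 1 by norm_num, Real.exp_nat_mul]
    exact pow_lt_pow_left₀ he (by norm_num) (by norm_num)
  have hbig : (4 * 7⁻¹ / 0.000001 : ℝ) < (2.7182818283 : ℝ) ^ 14 := by norm_num
  rw [show (-2 * 7 : ℝ) = -14 by norm_num, Real.exp_neg]
  have hpos : 0 < Real.exp 14 := Real.exp_pos _
  rw [div_lt_iff₀ (by norm_num : (0:ℝ) < 7)]
  have := hbig.trans h14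
  rw [div_lt_iff₀ (by norm_num)] at this
  have h' : 4 * (Real.exp 14)⁻¹ * Real.exp 14 = 4 := by field_simp
  nlinarith [inv_pos.2 hpos]

/-- **The sign of the central value for `y ≥ 7.0556`**: `γ + log y − log 4π − T'(y) > 0`, hence
`Re Λ_z(½) > 0`. [cite: BatemanGrosswald1964, Theorem 3 (10)] -/
theorem re_Λ_half_pos_of_le (z : ℍ) (hk : (7.0556 : ℝ) ≤ z.im) :
    0 < ((thetaFEPair z).Λ ((1 / 2 : ℝ) : ℂ)).re := by
  set y := z.im with hydef
  have hy1 : 1 < y := by linarith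
  have hy7 : 7 ≤ y := by linarith
  have hy0 : 0 < y := by linarith
  have hsy : 0 < Real.sqrt y := Real.sqrt_pos.2 hy0
  have hsharp := re_Λ_half_ge_sharp z hy1
  have htail := tail_le hy1
  have htail0 : 0 ≤ ∫ u in Ioc 0 (1 / y), u ^ (-(1 / 2 : ℝ)) * (evenKernel 0 u - u ^ (-(1 / 2 : ℝ))) :=
    setIntegral_nonneg measurableSet_Ioc fun u hu => tail_nonneg hu.1
  -- `4e^{-2y}/y ≤ 4e^{-14}/7 < 10⁻⁶`
  have hexp : 4 * Real.exp (-2 * y) / y ≤ 4 * Real.exp (-2 * 7) / 7 := by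
    have h1 : Real.exp (-2 * y) ≤ Real.exp (-2 * 7) := Real.exp_le_exp.2 (by linarith)
    have h2 : 0 < Real.exp (-2 * y) := Real.exp_pos _
    calc 4 * Real.exp (-2 * y) / y ≤ 4 * Real.exp (-2 * 7) / y := by gcongr
      _ ≤ 4 * Real.exp (-2 * 7) / 7 := by
        apply div_le_div_of_nonneg_left (by positivity) (by norm_num) hy7
  have hnum := four_mul_exp_neg_fourteen_lt
  have hlogπ := log_four_pi_sub_log_lt
  have hγ := Literature.Analysis.SpecialFunctions.Real.eulerMascheroniConstant_gt_d8
  have hlog : Real.log 7.0556 ≤ Real.log y := Real.log_le_log (by norm_num) hk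
  -- the bracket is positive
  have hbr : 0 < Real.eulerMascheroniConstant + Real.log y - Real.log (4 * Real.pi) -
      ∫ u in Ioc 0 (1 / y), u ^ (-(1 / 2 : ℝ)) * (evenKernel 0 u - u ^ (-(1 / 2 : ℝ))) := by
    linarith
  have : 0 < 2 * Real.sqrt y * (Real.eulerMascheroniConstant + Real.log y - Real.log (4 * Real.pi) -
      ∫ u in Ioc 0 (1 / y), u ^ (-(1 / 2 : ℝ)) * (evenKernel 0 u - u ^ (-(1 / 2 : ℝ)))) := by
    positivity
  nlinarith


/-! ## Bateman–Grosswald (10) and the discharge of `BatemanGrosswald1964_realZero` -/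

variable {a b c : ℝ}

/-- **Bateman–Grosswald 1964, (10) (PROVED): "`Z(½) > 0` if `k ≥ 7.0556`."** For a positive
definite real form `Q = ax² + bxy + cy²` with `k = √|d|/(2a) ≥ 7.0556`, the value at `½` of every
analytic continuation of `ζ_Q` has positive real part (it is real, `im_Λ_ofReal`).
[cite: BatemanGrosswald1964, Theorem 3 (10)] -/
theorem re_half_pos_of_le_starkK (h : IsPosDefForm a b c) (hk : (7.0556 : ℝ) ≤ starkK a b c)
    {Z : ℂ → ℂ} (hZ : IsEpsteinContinuation a b c Z) : 0 < (Z (1 / 2)).re := by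
  obtain ⟨z, hre, him, hk'⟩ := exists_zQ' h
  have hZ' : IsEpsteinContinuation c b a Z := (isEpsteinContinuation_swap_iff a b c Z).2 hZ
  have hΛ : 0 < ((thetaFEPair z).Λ ((1 / 2 : ℝ) : ℂ)).re :=
    re_Λ_half_pos_of_le z (by rw [hk']; exact hk)
  have e := continuation_ofReal_eq h.swap z hre him hZ' (σ := 1 / 2) (by norm_num) (by norm_num)
  have hhalf : ((1 / 2 : ℝ) : ℂ) = 1 / 2 := by push_cast; rfl
  rw [hhalf] at e hΛ
  rw [e, Complex.re_ofReal_mul]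
  exact mul_pos (realFactor_pos h.swap (by norm_num)) hΛ

/-- **Discharge of `BatemanGrosswald1964_realZero`** ("`ζ(s, Q)` has a real zero between `½` and
`1` if `k > 7.0556`", for every analytic continuation of `ζ_Q`): Bateman–Grosswald (10) (above) and
their deduction from `Z(s) → −∞` (`s → 1⁻`), `BatemanGrosswald1964_realZero_of_half_pos`.
[cite: BatemanGrosswald1964, Theorem 3 (10) and p. 367] -/
theorem BatemanGrosswald1964_realZero_holds : BatemanGrosswald1964_realZero :=
  BatemanGrosswald1964_realZero_of_half_pos fun _ _ _ h hk _ hZ => re_half_pos_of_le_starkK h hk.le hZ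

/-- **The barrier `EpsteinZetaRealZeros` now rests on Stark's Theorem 1 alone.**
[cite: Stark1967EpsteinZeros, Theorem 1] -/
theorem EpsteinZetaRealZeros_of_stark (hS : Stark1967_thm1) : EpsteinZetaRealZeros :=
  ⟨BatemanGrosswald1964_realZero_holds, hS⟩

end Literature.Barriers.RiemannHypothesis
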